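import Literature.AlgebraicGeometry.HodgeTheory.ProjectiveCohomologicalHilbertPolynomials
import Literature.Algebra.Homology.LaurentCechSubquotientPresentation
import HarnessLib

/-!
# Cohomological Hilbert polynomials, Grothendieck (non-)vanishing and growth for subquotients `N' ⧸ N`

Brodmann–Sharp, *Local Cohomology* (2nd ed.), Ch. 17, for the polynomial ring `R = k[x_0, …, x_r]`
over a field and a finitely generated graded `R`-module `M`, in the tree's Čech language
(`H^i(ℙ^r, M~(n)) = H^i(Č_n(M))`, `= H^{i+1}_{R_+}(M)_n` for `i ≥ 1`):

* Thm. 17.1.7 / Ex. 17.1.13 — the cohomological Hilbert functions `n ↦ h^i(Č_n(M))` are polynomials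
  `p^i_M(n)` for `n ≪ 0`, `deg p^i_M ≤ i`, `Σ_i (-1)^i p^i_M = P_M` (the Hilbert polynomial), and the
  top one `p^d_M`, `d = deg P_M = dim Supp M~`, has degree exactly `d`;
* Thm. 6.1.4 / 17.1.10 (Grothendieck) — `H^i(Č_n(M)) = 0` for `i > d` and all `n`, while
  `H^d(Č_n(M)) ≠ 0` for all `n ≪ 0`: the cohomological dimension of `M~` is `deg P_M`.

The files `ProjectiveGrothendieckVanishing`, `ProjectiveCohomologicalHilbertFunctions` and
`ProjectiveCohomologicalHilbertPolynomials` prove all of this for graded QUOTIENTS `M = F_e ⧸ K` of a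
split bundle (`LaurentCech.quot`). This file transports the results to graded SUBQUOTIENTS
`M = N' ⧸ N` (`N ≤ N' ⊆ F_e` graded; complex `LaurentCech.subquot e N N' h n`) — the form in which
ideal sheaves `𝓘_{Z ⊂ X} = (N' ⧸ N)~` of closed subschemes `Z = (F_e ⧸ N')~ ⊆ X = (F_e ⧸ N)~ ⊆ ℙ^r`
occur in the tree — along `LaurentCechSubquotientPresentation.exists_quot_finrank_homology_eq_subquot`
(`N' ⧸ N ≅ F_{e'} ⧸ φ⁻¹N` for a presentation `φ : F_{e'} ↠ N'`, with the same Čech cohomology in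
every twist). With `Q` the `χ`-polynomial of `N' ⧸ N`
(`LaurentCechHilbertPolynomial.exists_polynomial_eulerCharSubquot`):

* `isZero_homology_subquot_of_natDegree_hilbertPolynomial_lt` — **Grothendieck vanishing in the
  sharp form `H^i(Č_n(N' ⧸ N)) = 0` for `i > deg Q`, all `n`** (the earlier
  `ProjectiveGrothendieckVanishing.isZero_homology_subquot_of_natDegree_lt` only gave
  `i > max(deg Q_X, deg Q_Z + 1)` from the long exact sequence);
* `exists_forall_nontrivial_homology_subquot_natDegree` — **Grothendieck non-vanishing
  `H^{deg Q}(Č_n(N' ⧸ N)) ≠ 0` for all `n ≪ 0`** (`Q ≠ 0`); `natDegree_hilbertPolynomial_subquot_le`;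
  `natDegree_lt_iff_forall_isZero_homology_subquot` — `cd(N' ⧸ N)~ = deg Q`;
* `exists_polynomial_finrank_homology_subquot` (any field),
  `exists_polynomial_natDegree_le_finrank_homology_subquot` (`deg ≤ i`),
  `cohomologicalHilbertPolynomial_subquot_unique`,
  `natDegree_eq_of_finrank_homology_subquot_natDegree` (`deg p_d = d`, leading coefficient
  `(-1)^d · lc Q`), `exists_cohomologicalHilbertPolynomials_subquot_sum_eq` (`Σ (-1)^i p_i = Q`) —
  **Thm. 17.1.7 / 17.1.11 / Ex. 17.1.13 for subquotients**;
* `exists_finrank_homology_subquot_le_mul_pow` (`h^i(Č_{N₀-t}) ≤ C (t+1)^i`),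
  `exists_abs_finrank_homology_subquot_sub_signed_eval_le` (`h^d(Č_{N₀-t}) = (-1)^d Q(N₀-t) + O(t^{d-1})`),
  `exists_forall_le_finrank_homology_subquot_natDegree` (`h^d → ∞`).

## References

* [BrodmannSharp2013] M. P. Brodmann, R. Y. Sharp, *Local Cohomology*, 2nd ed., CUP 2013,
  Thm. 6.1.4, Thm. 17.1.7 (p. 406), 17.1.10–17.1.11 (p. 408), Ex. 17.1.13 (p. 409).
* [Hartshorne1977] R. Hartshorne, *Algebraic Geometry*, III Thm. 2.7 (p. 208), III Thm. 5.1–5.2,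
  Ex. 5.1–5.2 (pp. 225–230), III Thm. 7.1 (p. 240).
-/

noncomputable section

open CategoryTheory CategoryTheory.Limits Polynomial

universe u

namespace Literature.Algebra.Homology

namespace LaurentCech

open OrderedCech TopCohomology

variable {k : Type u} [Field k] {r : ℕ} {J : Type} [Finite J] (e : J → ℤ)

/-! ### Transport of the `χ`-polynomial along a presentation -/

omit [Finite J] in
/-- If `Č_n(F_{e'} ⧸ K')` and `Č_n(N' ⧸ N)` have cohomology of the same ranks, they have the same
`χ`-polynomial. [cite: Hartshorne1977, III Ex. 5.1 (p. 230)] -/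
theorem eulerChar_eq_of_finrank_homology_eq {J' : Type} {e' : J' → ℤ}
    {K' : Submodule (P k r) (J' → P k r)} {N N' : Submodule (P k r) (J → P k r)} {h : N ≤ N'}
    (hfin : ∀ d i : ℤ, Module.finrank k ((quot e' K' d).homology i) =
      Module.finrank k ((subquot e N N' h d).homology i))
    {Q : ℚ[X]}
    (hQ : ∀ n : ℤ, ((∑ q ∈ Finset.range (r + 1), (-1 : ℤ) ^ q *
      (Module.finrank k ((subquot e N N' h n).homology q) : ℤ) : ℤ) : ℚ) = Q.eval (n : ℚ)) (n : ℤ) :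
    ((∑ q ∈ Finset.range (r + 1), (-1 : ℤ) ^ q *
      (Module.finrank k ((quot e' K' n).homology q) : ℤ) : ℤ) : ℚ) = Q.eval (n : ℚ) := by
  rw [← hQ n]
  congr 1
  exact Finset.sum_congr rfl fun q _ => by rw [hfin n q]

/-! ### Grothendieck vanishing and non-vanishing for subquotients -/

/-- **Grothendieck vanishing for `(N' ⧸ N)~`, sharp form**: with `Q` the `χ`-polynomial of the graded
subquotient `N' ⧸ N` (`N ≤ N' ⊆ F_e` graded, `k` infinite, `r ≥ 1`),
**`H^i(Č_n(N' ⧸ N)) = 0` for every `i > deg Q` and every `n`** — e.g. for an ideal sheaf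
`𝓘 = (N' ⧸ N)~ ⊆ 𝒪_X`: `H^i(𝓘(n)) = 0` for `i > dim Supp 𝓘`.
[cite: BrodmannSharp2013, Thm. 6.1.4] [cite: Hartshorne1977, III Thm. 2.7 (p. 208)] -/
theorem isZero_homology_subquot_of_natDegree_hilbertPolynomial_lt [Infinite k] (hr : 1 ≤ r)
    {N N' : Submodule (P k r) (J → P k r)} (hN : IsGraded e N) (hN' : IsGraded e N') (h : N ≤ N')
    {Q : ℚ[X]}
    (hQ : ∀ n : ℤ, ((∑ q ∈ Finset.range (r + 1), (-1 : ℤ) ^ q *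
      (Module.finrank k ((subquot e N N' h n).homology q) : ℤ) : ℤ) : ℚ) = Q.eval (n : ℚ)) :
    ∀ i : ℤ, (Q.natDegree : ℤ) < i → ∀ n : ℤ, IsZero ((subquot e N N' h n).homology i) := by
  obtain ⟨n', e', K', hK', hfin, hzero⟩ := exists_quot_finrank_homology_eq_subquot hN hN' h
  intro i hi n
  exact (hzero n i).1 (isZero_homology_quot_of_natDegree_lt e' hr hK'
    (eulerChar_eq_of_finrank_homology_eq e hfin hQ) i hi n)

/-- **`deg Q ≤ r`** for the `χ`-polynomial `Q` of a graded subquotient `N' ⧸ N ⊆ F_e ⧸ N` on `ℙ^r`.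
[cite: BrodmannSharp2013, Thm. 17.1.7 (p. 406)] [cite: Hartshorne1977, III Ex. 5.2 (p. 230)] -/
theorem natDegree_hilbertPolynomial_subquot_le [Infinite k] (hr : 1 ≤ r)
    {N N' : Submodule (P k r) (J → P k r)} (hN : IsGraded e N) (hN' : IsGraded e N') (h : N ≤ N')
    {Q : ℚ[X]}
    (hQ : ∀ n : ℤ, ((∑ q ∈ Finset.range (r + 1), (-1 : ℤ) ^ q *
      (Module.finrank k ((subquot e N N' h n).homology q) : ℤ) : ℤ) : ℚ) = Q.eval (n : ℚ)) :
    Q.natDegree ≤ r := by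
  obtain ⟨n', e', K', hK', hfin, -⟩ := exists_quot_finrank_homology_eq_subquot hN hN' h
  exact natDegree_hilbertPolynomial_le e' hr hK' (eulerChar_eq_of_finrank_homology_eq e hfin hQ)

/-- **Grothendieck non-vanishing for `(N' ⧸ N)~`**: if `Q ≠ 0` then
**`H^{deg Q}(Č_n(N' ⧸ N)) ≠ 0` for all `n ≪ 0`**.
[cite: BrodmannSharp2013, Thm. 6.1.4] [cite: BrodmannSharp2013, Ex. 17.1.13 (p. 409)] -/
theorem exists_forall_nontrivial_homology_subquot_natDegree [Infinite k] (hr : 1 ≤ r)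
    {N N' : Submodule (P k r) (J → P k r)} (hN : IsGraded e N) (hN' : IsGraded e N') (h : N ≤ N')
    {Q : ℚ[X]}
    (hQ : ∀ n : ℤ, ((∑ q ∈ Finset.range (r + 1), (-1 : ℤ) ^ q *
      (Module.finrank k ((subquot e N N' h n).homology q) : ℤ) : ℤ) : ℚ) = Q.eval (n : ℚ))
    (hQ0 : Q ≠ 0) :
    ∃ n₀ : ℤ, ∀ n : ℤ, n ≤ n₀ → Nontrivial ((subquot e N N' h n).homology (Q.natDegree : ℤ)) := by
  obtain ⟨n', e', K', hK', hfin, -⟩ := exists_quot_finrank_homology_eq_subquot hN hN' h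
  obtain ⟨n₀, hn₀⟩ := exists_forall_nontrivial_homology_quot_natDegree e' hr hK'
    (eulerChar_eq_of_finrank_homology_eq e hfin hQ) hQ0
  refine ⟨n₀, fun n hn => ?_⟩
  haveI := hn₀ n hn
  haveI := moduleFinite_homology_quot e' hK' n (Q.natDegree : ℤ)
  haveI := moduleFinite_homology_subquot e hN hN' h n (Q.natDegree : ℤ)
  have hpos : 0 < Module.finrank k ((quot e' K' n).homology (Q.natDegree : ℤ)) :=
    (Module.finrank_pos_iff (R := k)).2 (hn₀ n hn)
  rw [hfin] at hpos
  exact (Module.finrank_pos_iff (R := k)).1 hpos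

/-- Hence `H^{deg Q}(Č_n(N' ⧸ N)) ≠ 0` for some `n` (`Q ≠ 0`).
[cite: BrodmannSharp2013, Thm. 6.1.4] -/
theorem exists_not_isZero_homology_subquot_natDegree [Infinite k] (hr : 1 ≤ r)
    {N N' : Submodule (P k r) (J → P k r)} (hN : IsGraded e N) (hN' : IsGraded e N') (h : N ≤ N')
    {Q : ℚ[X]}
    (hQ : ∀ n : ℤ, ((∑ q ∈ Finset.range (r + 1), (-1 : ℤ) ^ q *
      (Module.finrank k ((subquot e N N' h n).homology q) : ℤ) : ℤ) : ℚ) = Q.eval (n : ℚ))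
    (hQ0 : Q ≠ 0) : ∃ n : ℤ, ¬ IsZero ((subquot e N N' h n).homology (Q.natDegree : ℤ)) := by
  obtain ⟨n', e', K', hK', hfin, hzero⟩ := exists_quot_finrank_homology_eq_subquot hN hN' h
  obtain ⟨n, hn⟩ := exists_not_isZero_homology_quot_natDegree e' hr hK'
    (eulerChar_eq_of_finrank_homology_eq e hfin hQ) hQ0
  exact ⟨n, fun hz => hn ((hzero n _).2 hz)⟩

/-- **The cohomological dimension of `(N' ⧸ N)~` is `deg Q`**: for `Q ≠ 0` and `i : ℕ`,
`deg Q < i ↔ H^j(Č_n(N' ⧸ N)) = 0` for all `j ≥ i` and all `n`.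
[cite: BrodmannSharp2013, Thm. 6.1.4] [cite: Hartshorne1977, III Thm. 2.7 (p. 208)] -/
theorem natDegree_lt_iff_forall_isZero_homology_subquot [Infinite k] (hr : 1 ≤ r)
    {N N' : Submodule (P k r) (J → P k r)} (hN : IsGraded e N) (hN' : IsGraded e N') (h : N ≤ N')
    {Q : ℚ[X]}
    (hQ : ∀ n : ℤ, ((∑ q ∈ Finset.range (r + 1), (-1 : ℤ) ^ q *
      (Module.finrank k ((subquot e N N' h n).homology q) : ℤ) : ℤ) : ℚ) = Q.eval (n : ℚ))
    (hQ0 : Q ≠ 0) (i : ℕ) :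
    Q.natDegree < i ↔
      ∀ j : ℤ, (i : ℤ) ≤ j → ∀ n : ℤ, IsZero ((subquot e N N' h n).homology j) := by
  obtain ⟨n', e', K', hK', hfin, hzero⟩ := exists_quot_finrank_homology_eq_subquot hN hN' h
  rw [natDegree_lt_iff_forall_isZero_homology e' hr hK' (eulerChar_eq_of_finrank_homology_eq e hfin hQ)
    hQ0 i]
  exact ⟨fun H j hj n => (hzero n j).1 (H j hj n), fun H j hj n => (hzero n j).2 (H j hj n)⟩

/-! ### Cohomological Hilbert polynomials of subquotients -/

/-- **Brodmann–Sharp Thm. 17.1.7 for `M = N' ⧸ N`, any field**: for every `i` there are `p ∈ ℚ[X]`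
and `n₀` with `h^i(Č_n(N' ⧸ N)) = p(n)` for all `n ≤ n₀`.
[cite: BrodmannSharp2013, Thm. 17.1.7 (p. 406)] [cite: Hartshorne1977, III Thm. 7.1 (p. 240)] -/
theorem exists_polynomial_finrank_homology_subquot (hr : 1 ≤ r)
    {N N' : Submodule (P k r) (J → P k r)} (hN : IsGraded e N) (hN' : IsGraded e N') (h : N ≤ N')
    (i : ℕ) :
    ∃ p : ℚ[X], ∃ n₀ : ℤ, ∀ n : ℤ, n ≤ n₀ →
      (Module.finrank k ((subquot e N N' h n).homology i) : ℚ) = p.eval (n : ℚ) := by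
  obtain ⟨n', e', K', hK', hfin, -⟩ := exists_quot_finrank_homology_eq_subquot hN hN' h
  obtain ⟨p, n₀, hp⟩ := exists_polynomial_finrank_homology_quot e' hr hK' i
  exact ⟨p, n₀, fun n hn => by rw [← hfin n i]; exact hp n hn⟩

/-- **… with `deg p ≤ i`** (`k` infinite). [cite: BrodmannSharp2013, Thm. 17.1.7 (p. 406)] -/
theorem exists_polynomial_natDegree_le_finrank_homology_subquot [Infinite k] (hr : 1 ≤ r)
    {N N' : Submodule (P k r) (J → P k r)} (hN : IsGraded e N) (hN' : IsGraded e N') (h : N ≤ N')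
    (i : ℕ) :
    ∃ p : ℚ[X], p.natDegree ≤ i ∧ ∃ n₀ : ℤ, ∀ n : ℤ, n ≤ n₀ →
      (Module.finrank k ((subquot e N N' h n).homology i) : ℚ) = p.eval (n : ℚ) := by
  obtain ⟨n', e', K', hK', hfin, -⟩ := exists_quot_finrank_homology_eq_subquot hN hN' h
  obtain ⟨p, hpi, n₀, hp⟩ := exists_polynomial_natDegree_le_finrank_homology_quot e' hr hK' i
  exact ⟨p, hpi, n₀, fun n hn => by rw [← hfin n i]; exact hp n hn⟩

omit [Finite J] in
/-- The cohomological Hilbert polynomials of `N' ⧸ N` are uniquely determined.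
[cite: BrodmannSharp2013, Thm. 17.1.7 (p. 406)] -/
theorem cohomologicalHilbertPolynomial_subquot_unique {N N' : Submodule (P k r) (J → P k r)}
    {h : N ≤ N'} {i : ℤ} {p q : ℚ[X]} {n₀ n₁ : ℤ}
    (hp : ∀ n : ℤ, n ≤ n₀ →
      (Module.finrank k ((subquot e N N' h n).homology i) : ℚ) = p.eval (n : ℚ))
    (hq : ∀ n : ℤ, n ≤ n₁ →
      (Module.finrank k ((subquot e N N' h n).homology i) : ℚ) = q.eval (n : ℚ)) :
    p = q := by
  refine Polynomial.eq_of_infinite_eval_eq p q ?_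
  have hinj : Function.Injective (fun n : Set.Iic (min n₀ n₁) => ((n : ℤ) : ℚ)) := by
    intro a b hab
    have hab' : ((a : ℤ) : ℚ) = ((b : ℤ) : ℚ) := hab
    exact Subtype.ext (by exact_mod_cast hab')
  refine Set.infinite_of_injective_forall_mem hinj fun n => ?_
  change p.eval ((n : ℤ) : ℚ) = q.eval ((n : ℤ) : ℚ)
  rw [← hp n (le_trans n.2 (min_le_left _ _)), hq n (le_trans n.2 (min_le_right _ _))]

/-- **Brodmann–Sharp Ex. 17.1.13 for `M = N' ⧸ N`**: if `d = deg Q ≥ 1`, the cohomological Hilbert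
polynomial `p` of `H^d(Č_n(N' ⧸ N))` has degree exactly `d` and leading coefficient
`(-1)^d · lc(Q)`. [cite: BrodmannSharp2013, Ex. 17.1.13 (p. 409)] -/
theorem natDegree_eq_of_finrank_homology_subquot_natDegree [Infinite k] (hr : 1 ≤ r)
    {N N' : Submodule (P k r) (J → P k r)} (hN : IsGraded e N) (hN' : IsGraded e N') (h : N ≤ N')
    {Q : ℚ[X]}
    (hQ : ∀ n : ℤ, ((∑ q ∈ Finset.range (r + 1), (-1 : ℤ) ^ q *
      (Module.finrank k ((subquot e N N' h n).homology q) : ℤ) : ℤ) : ℚ) = Q.eval (n : ℚ))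
    (hd : 1 ≤ Q.natDegree) {p : ℚ[X]} {n₀ : ℤ}
    (hp : ∀ n : ℤ, n ≤ n₀ →
      (Module.finrank k ((subquot e N N' h n).homology (Q.natDegree : ℤ)) : ℚ) = p.eval (n : ℚ)) :
    p.natDegree = Q.natDegree ∧ p.leadingCoeff = (-1) ^ Q.natDegree * Q.leadingCoeff := by
  obtain ⟨n', e', K', hK', hfin, -⟩ := exists_quot_finrank_homology_eq_subquot hN hN' h
  exact natDegree_eq_of_finrank_homology_quot_natDegree e' hr hK'
    (eulerChar_eq_of_finrank_homology_eq e hfin hQ) hd (fun n hn => by rw [hfin]; exact hp n hn)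

/-- **Brodmann–Sharp Thm. 17.1.7 (iii) for `M = N' ⧸ N`**: cohomological Hilbert polynomials
`p_0, …, p_r` with `h^i(Č_n(N' ⧸ N)) = p_i(n)` for `n ≤ n₀` and **`Σ_i (-1)^i p_i = Q`**.
[cite: BrodmannSharp2013, Thm. 17.1.7 (p. 406)] [cite: Hartshorne1977, III Ex. 5.1 (p. 230)] -/
theorem exists_cohomologicalHilbertPolynomials_subquot_sum_eq (hr : 1 ≤ r)
    {N N' : Submodule (P k r) (J → P k r)} (hN : IsGraded e N) (hN' : IsGraded e N') (h : N ≤ N')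
    {Q : ℚ[X]}
    (hQ : ∀ n : ℤ, ((∑ q ∈ Finset.range (r + 1), (-1 : ℤ) ^ q *
      (Module.finrank k ((subquot e N N' h n).homology q) : ℤ) : ℤ) : ℚ) = Q.eval (n : ℚ)) :
    ∃ p : ℕ → ℚ[X], ∃ n₀ : ℤ,
      (∀ i : ℕ, i ≤ r → ∀ n : ℤ, n ≤ n₀ →
        (Module.finrank k ((subquot e N N' h n).homology i) : ℚ) = (p i).eval (n : ℚ)) ∧
      ∑ i ∈ Finset.range (r + 1), Polynomial.C ((-1 : ℚ) ^ i) * p i = Q := by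
  obtain ⟨n', e', K', hK', hfin, -⟩ := exists_quot_finrank_homology_eq_subquot hN hN' h
  obtain ⟨p, n₀, hp, hsum⟩ := exists_cohomologicalHilbertPolynomials_sum_eq e' hr hK'
    (eulerChar_eq_of_finrank_homology_eq e hfin hQ)
  exact ⟨p, n₀, fun i hi n hn => by rw [← hfin n i]; exact hp i hi n hn, hsum⟩

/-! ### Growth of the cohomological Hilbert functions of subquotients -/

/-- **`h^i(Č_{N₀ - t}(N' ⧸ N)) ≤ C · (t + 1)^i`** for all `t ∈ ℕ`.
[cite: BrodmannSharp2013, Thm. 17.1.11 (p. 408)] -/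
theorem exists_finrank_homology_subquot_le_mul_pow [Infinite k] (hr : 1 ≤ r)
    {N N' : Submodule (P k r) (J → P k r)} (hN : IsGraded e N) (hN' : IsGraded e N') (h : N ≤ N')
    (i : ℕ) (N₀ : ℤ) :
    ∃ C : ℕ, ∀ t : ℕ, Module.finrank k ((subquot e N N' h (N₀ - t)).homology i) ≤ C * (t + 1) ^ i := by
  obtain ⟨n', e', K', hK', hfin, -⟩ := exists_quot_finrank_homology_eq_subquot hN hN' h
  obtain ⟨C, hC⟩ := exists_finrank_homology_quot_le_mul_pow e' hr hK' i N₀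
  exact ⟨C, fun t => by rw [← hfin]; exact hC t⟩

/-- **`h^d(Č_{N₀ - t}(N' ⧸ N)) = (-1)^d Q(N₀ - t) + O(t^{d-1})`**, `d = deg Q ≥ 1`.
[cite: BrodmannSharp2013, Ex. 17.1.13 (p. 409)] -/
theorem exists_abs_finrank_homology_subquot_sub_signed_eval_le [Infinite k] (hr : 1 ≤ r)
    {N N' : Submodule (P k r) (J → P k r)} (hN : IsGraded e N) (hN' : IsGraded e N') (h : N ≤ N')
    {Q : ℚ[X]}
    (hQ : ∀ n : ℤ, ((∑ q ∈ Finset.range (r + 1), (-1 : ℤ) ^ q *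
      (Module.finrank k ((subquot e N N' h n).homology q) : ℤ) : ℤ) : ℚ) = Q.eval (n : ℚ))
    (hd : 1 ≤ Q.natDegree) (N₀ : ℤ) :
    ∃ C : ℕ, ∀ t : ℕ,
      |(Module.finrank k ((subquot e N N' h (N₀ - t)).homology (Q.natDegree : ℤ)) : ℚ) -
        (-1) ^ Q.natDegree * Q.eval ((N₀ : ℚ) - t)| ≤
          C * ((t : ℚ) + 1) ^ (Q.natDegree - 1) := by
  obtain ⟨n', e', K', hK', hfin, -⟩ := exists_quot_finrank_homology_eq_subquot hN hN' h
  obtain ⟨C, hC⟩ := exists_abs_finrank_sub_signed_eval_le e' hr hK'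
    (eulerChar_eq_of_finrank_homology_eq e hfin hQ) hd N₀
  exact ⟨C, fun t => by rw [← hfin]; exact hC t⟩

/-- **`h^d(Č_n(N' ⧸ N)) → ∞` as `n → -∞`**, `d = deg Q ≥ 1`: every bound `B` is exceeded for all
`n ≤ n₀`. [cite: BrodmannSharp2013, Ex. 17.1.13 (p. 409)] -/
theorem exists_forall_le_finrank_homology_subquot_natDegree [Infinite k] (hr : 1 ≤ r)
    {N N' : Submodule (P k r) (J → P k r)} (hN : IsGraded e N) (hN' : IsGraded e N') (h : N ≤ N')
    {Q : ℚ[X]}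
    (hQ : ∀ n : ℤ, ((∑ q ∈ Finset.range (r + 1), (-1 : ℤ) ^ q *
      (Module.finrank k ((subquot e N N' h n).homology q) : ℤ) : ℤ) : ℚ) = Q.eval (n : ℚ))
    (hd : 1 ≤ Q.natDegree) (B : ℕ) :
    ∃ n₀ : ℤ, ∀ n : ℤ, n ≤ n₀ →
      B ≤ Module.finrank k ((subquot e N N' h n).homology (Q.natDegree : ℤ)) := by
  obtain ⟨n', e', K', hK', hfin, -⟩ := exists_quot_finrank_homology_eq_subquot hN hN' h
  obtain ⟨n₀, hn₀⟩ := exists_forall_le_finrank_homology_quot_natDegree e' hr hK'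
    (eulerChar_eq_of_finrank_homology_eq e hfin hQ) hd B
  exact ⟨n₀, fun n hn => by rw [← hfin]; exact hn₀ n hn⟩

end LaurentCech

end Literature.Algebra.Homology

end
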